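import Summits.BirchSwinnertonDyer.BirchSwinnertonDyer.Theorems.ManinLocalTwoThreeGenerationTelescope
import Summits.BirchSwinnertonDyer.BirchSwinnertonDyer.Theorems.ManinLocalTwoThreeGenerationCocycleHecke
import HarnessLib

/-!
# Route `ManinLocalTwoThree`, crux C2 `ManinOddAtFour` (stmt-BirchSwinnertonDyer-22967): the generation stub
# `stub_multiShiftClass_generation` = E-es-22 `MultiShiftClassGenerationTwo` FROM the cell's relative Ihara statement E-es-25
# at `(p,t,n) = (2,2,3)` and `(2,q,1)` (`q` odd prime) — typer g4's typed single-shift form `RelativeIharaShiftVanishing`,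
# bodies inlined VERBATIM (HOME/typer, not yet a tree constant) — AND the non-Eisenstein property of `ℓ ↦ a_ℓ(W) mod 2`
# for `W[2]` irreducible (line prover p3; CONDITIONAL)

Composition of the landed chain for `p = 2`: `multiShiftClassGenerationTwo_iff_functionals` (lattice Nakayama),
`functionalCocycle_mem_cocycles` + `isHeckeGenEigenvector_functionalCocycle` (the cocycle `u_φ(γ) = φ({∞, γ∞}_f)` is a Hecke
eigen-cocycle for `a_ℓ(W)`), the column description `periodLattice_multiShiftOldform_eq_closure_columns` of `Λ_{h₂}`,
`h₂ = Σ_{T ⊆ Gen(N)} (−1)^{|T|} f∣ι_{∏T}`, `Gen(N) = {8} ∪ {q ∥ N}`, and the telescoping `eq_zero_of_altSum_conjAt_eq_zero`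
(MEMO-es §21.3) through the tower `N → 8N → 8Nq₁ → ⋯`. Hypotheses, NOT proved here and NOT asserted: `hRI8`, `hRIq` =
E-es-25 in the typer's cocycle currency (a theorem-candidate of the cell with a proof sketch, refereeing pending), `hNE` =
«`W[2]` irreducible ⟹ `ℓ ↦ a_ℓ(W) mod 2` is not narrow-Eisenstein» (to be cited as a Literature fact). Nothing about BSD or
Manin's conjecture is proved here; E-es-22 is proved only under `hRI8 ∧ hRIq ∧ hNE`.
-/

set_option autoImplicit false
set_option linter.dupNamespace false

noncomputable section

open scoped MatrixGroups BigOperators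

open CongruenceSubgroup Literature.NumberTheory.EllipticCurves.ModularForms
  Literature.NumberTheory.EllipticCurves.ModularForms.HidaCohomology

namespace Summit.BirchSwinnertonDyer.BirchSwinnertonDyer.Theorems.ManinLocalTwoThree

open scoped Classical ModularForm
open Matrix.SpecialLinearGroup ModularGroup Literature.NumberTheory.EllipticCurves
  Summit.BirchSwinnertonDyer.Rank1Residual.ManinAdditive

/-- **E-es-22 ⟸ E-es-25 at `(2,2,3)` and at `(2,q,1)` for odd primes `q` ∧ (non-Eisenstein at 2).** `hRI8` / `hRIq` are
the typer's `RelativeIharaShiftVanishing 2 2 3` / `RelativeIharaShiftVanishing 2 q 1` VERBATIM (single-shift relative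
Ihara vanishing for `λ`-generalised Hecke eigen-cocycles in `Hom(Γ₀(L), K)`, `char K = 2`, `λ` not narrow-Eisenstein);
`hNE`: for `W[2]` irreducible the system `ℓ ↦ a_ℓ(W) mod 2` is not narrow-Eisenstein. Then `MultiShiftClassGenerationTwo`:
by `multiShiftClassGenerationTwo_iff_functionals` it suffices that a functional `φ : Λ_f → 𝔽₂` killing `Λ_{h₂}` vanishes;
its cocycle `u_φ` is a Hecke eigen-cocycle (`isHeckeGenEigenvector_functionalCocycle`) whose alternating sum over
`Gen(N) = {8} ∪ {q ∥ N}` on `Γ₀(N·8·∏q)` is `φ` of a column element of `Λ_{h₂}` (`periodLattice_multiShiftOldform_eq_closure_columns`),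
hence `0`; the telescoping `eq_zero_of_altSum_conjAt_eq_zero` gives `u_φ = 0`, so `φ = 0`. [folklore] -/
theorem multiShiftClassGenerationTwo_of_relativeIhara
    (hRI8 : ∀ (K : Type) [Field K] [CharP K 2] (L : ℕ) [NeZero L] [NeZero (2 : ℕ)] (S : Finset ℕ) (lam : ℕ → K)
      (u : cocycles 0 L K),
      (∀ q : ℕ, q.Prime → q ∣ 2 * 2 * L → q ∈ S) →
      IsHeckeGenEigenvector S lam u →
      ¬ IsNarrowEisensteinEigensystem 2 lam →
      degeneracyPullback 0 L (L * 2 ^ 3) (2 ^ 3) K dvd_rfl (u : Gamma0 L → Fin 1 → K) =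
        degeneracyPullback 0 L (L * 2 ^ 3) 1 K (by simp) (u : Gamma0 L → Fin 1 → K) →
      u = 0)
    (hRIq : ∀ t : ℕ, t.Prime → t ≠ 2 →
      ∀ (K : Type) [Field K] [CharP K 2] (L : ℕ) [NeZero L] [NeZero t] (S : Finset ℕ) (lam : ℕ → K)
      (u : cocycles 0 L K),
      (∀ q : ℕ, q.Prime → q ∣ 2 * t * L → q ∈ S) →
      IsHeckeGenEigenvector S lam u →
      ¬ IsNarrowEisensteinEigensystem 2 lam →
      degeneracyPullback 0 L (L * t ^ 1) (t ^ 1) K dvd_rfl (u : Gamma0 L → Fin 1 → K) =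
        degeneracyPullback 0 L (L * t ^ 1) 1 K (by simp) (u : Gamma0 L → Fin 1 → K) →
      u = 0)
    (hNE : ∀ (W : WeierstrassCurve ℚ) [W.IsElliptic], W.HasIrreducibleModPGaloisRep 2 →
      ¬ IsNarrowEisensteinEigensystem 2 (fun ℓ : ℕ => ((W.LFunction ℓ : ℤ) : ZMod 2))) :
    MultiShiftClassGenerationTwo := by
  haveI : Fact (Nat.Prime 2) := ⟨Nat.prime_two⟩
  rw [multiShiftClassGenerationTwo_iff_functionals]
  intro W _ N _ f hf h4 hirr φ hφ
  have hN0 : 0 < N := Nat.pos_of_ne_zero (NeZero.ne N)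
  have h4' : 4 ∣ N := by norm_num at h4; exact h4
  have h2N : 2 ∣ N := dvd_trans (by norm_num) h4'
  -- `Gen(N)` as a list of prime powers `2^3 :: (q^1 : q ∥ N)`
  set G : Finset ℕ := N.primeFactors.filter fun q => ¬ q ^ 2 ∣ N with hG
  have hGprime : ∀ q ∈ G, q.Prime ∧ ¬ q ^ 2 ∣ N := fun q hq => by
    rw [hG, Finset.mem_filter] at hq
    exact ⟨(Nat.mem_primeFactors.mp hq.1).1, hq.2⟩
  have hGne2 : ∀ q ∈ G, q ≠ 2 := by
    rintro q hq rfl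
    exact (hGprime 2 hq).2 h4
  set ds : List ℕ := (2 ^ 3) :: (G.toList.map fun t => t ^ 1) with hds
  have hmap : (G.toList.map fun t => t ^ 1) = G.toList := by simp
  have h8G : (2 ^ 3 : ℕ) ∉ G.toList := fun h => by
    have h8 := (hGprime _ (Finset.mem_toList.mp h)).1
    norm_num at h8
  have hnd : ds.Nodup := by
    rw [hds, hmap]
    exact List.nodup_cons.mpr ⟨h8G, Finset.nodup_toList G⟩
  have hpos : ∀ d ∈ ds, 0 < d := by
    intro d hd
    rw [hds, hmap] at hd
    rcases List.mem_cons.mp hd with rfl | hd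
    · norm_num
    · exact (hGprime d (Finset.mem_toList.mp hd)).1.pos
  have hdsF : ds.toFinset = insert 8 G := by
    rw [hds, hmap, List.toFinset_cons, Finset.toList_toFinset]
    norm_num
  have hprod0 : ds.prod ≠ 0 := fun h0 => lt_irrefl 0 (hpos 0 (List.prod_eq_zero_iff.mp h0))
  -- the level `M = N · 8 · ∏ q` and the prime set `S`
  set M : ℕ := N * ds.prod with hM
  have hM0 : M ≠ 0 := Nat.mul_ne_zero (NeZero.ne N) hprod0
  haveI : NeZero M := ⟨hM0⟩
  have hNM : N ∣ M := dvd_mul_right N _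
  have hL : 1 < M := lt_of_lt_of_le (by omega : 1 < N) (Nat.le_of_dvd (Nat.pos_of_ne_zero hM0) hNM)
  set S : Finset ℕ := M.primeFactors with hS
  have hSM : ∀ q : ℕ, q.Prime → q ∣ M → q ∈ S := fun q hq hqd =>
    (Nat.mem_primeFactors_of_ne_zero hM0).mpr ⟨hq, hqd⟩
  -- the functional cocycle `u_φ`
  set u : cocycles 0 N (ZMod 2) :=
    ⟨fun (γ : Gamma0 N) (_ : Fin 1) => φ ⟨cuspSymbol f γ, cuspSymbol_mem_periodLattice f γ⟩,
      functionalCocycle_mem_cocycles f φ⟩ with hu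
  have hgen : IsHeckeGenEigenvector S (fun ℓ : ℕ => ((W.LFunction ℓ : ℤ) : ZMod 2)) u :=
    isHeckeGenEigenvector_functionalCocycle hf φ S
  have hne := hNE W hirr
  -- the single-shift steps at every modulus of `ds`, at all levels divisible by `N`
  have hRI : ∀ d ∈ ds, ∀ (L' : ℕ) [NeZero L'] [NeZero d] (v : cocycles 0 L' (ZMod 2)), N ∣ L' →
      (∀ q : ℕ, q.Prime → q ∣ L' * d → q ∈ S) →
      IsHeckeGenEigenvector S (fun ℓ : ℕ => ((W.LFunction ℓ : ℤ) : ZMod 2)) v →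
      degeneracyPullback 0 L' (L' * d) d (ZMod 2) dvd_rfl (v : Gamma0 L' → Fin 1 → ZMod 2) =
        degeneracyPullback 0 L' (L' * d) 1 (ZMod 2) (by simp) (v : Gamma0 L' → Fin 1 → ZMod 2) →
      v = 0 := by
    intro d hd
    rw [hds] at hd
    rcases List.mem_cons.mp hd with rfl | hd
    · intro L' _ _ v hNL hS' hv heq
      refine hRI8 (ZMod 2) L' S _ v (fun q hq hqd => ?_) hv hne heq
      rcases (Nat.Prime.dvd_mul hq).mp hqd with h | h
      · have h2 : q ∣ 2 := by rcases (Nat.Prime.dvd_mul hq).mp h with h | h <;> exact h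
        have hq2 : q = 2 := (Nat.prime_dvd_prime_iff_eq hq Nat.prime_two).mp h2
        subst hq2
        exact hS' 2 hq (dvd_mul_of_dvd_right (by norm_num) _)
      · exact hS' q hq (h.mul_right _)
    · obtain ⟨t, ht, rfl⟩ := List.mem_map.mp hd
      have htp := (hGprime t (Finset.mem_toList.mp ht)).1
      have ht2 := hGne2 t (Finset.mem_toList.mp ht)
      intro L' _ _ v hNL hS' hv heq
      haveI : NeZero t := ⟨htp.ne_zero⟩
      refine hRIq t htp ht2 (ZMod 2) L' S _ v (fun q hq hqd => ?_) hv hne heq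
      rcases (Nat.Prime.dvd_mul hq).mp hqd with h | h
      · rcases (Nat.Prime.dvd_mul hq).mp h with h | h
        · have hq2 : q = 2 := (Nat.prime_dvd_prime_iff_eq hq Nat.prime_two).mp h
          subst hq2
          exact hS' 2 hq ((h2N.trans hNL).mul_right _)
        · exact hS' q hq (dvd_mul_of_dvd_right (by rw [pow_one]; exact h) _)
      · exact hS' q hq (h.mul_right _)
  -- the alternating sum of `u_φ` over `Gen(N)` vanishes on `Γ₀(M)`: it is `φ` of a column element of `Λ_{h₂}`
  have hsum : ∀ (γ : Gamma0 M) (i : Fin 1),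
      ∑ T ∈ ds.toFinset.powerset,
        (-1 : ℤ) ^ T.card • (u : Gamma0 N → Fin 1 → ZMod 2) (conjAt N M (∏ t ∈ T, t) γ) i = 0 := by
    intro γ i
    have he : ((γ : SL(2, ℤ)) 1 1 : ℤ) ≠ 0 := apply_one_one_ne_zero_of_one_lt hL γ
    have hterm : ∀ T ∈ ds.toFinset.powerset,
        (-1 : ℤ) ^ T.card • (u : Gamma0 N → Fin 1 → ZMod 2) (conjAt N M (∏ t ∈ T, t) γ) i =
          φ ((-1 : ℤ) ^ T.card •
            ⟨cuspSymbol f (conjAt N M (∏ t ∈ T, t) γ), cuspSymbol_mem_periodLattice f _⟩) := by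
      intro T _
      rw [map_zsmul]
    rw [Finset.sum_congr rfl hterm, ← map_sum]
    apply hφ
    rw [AddSubmonoidClass.coe_finsetSum, periodLattice_multiShiftOldform_eq_closure_columns f h4', ← hdsF]
    apply AddSubgroup.subset_closure
    refine ⟨((γ : SL(2, ℤ)) 0 1 : ℤ), ((γ : SL(2, ℤ)) 1 1 : ℤ), he, ?_, ?_⟩
    · have hN' : IsCoprime ((γ : SL(2, ℤ)) 1 1 : ℤ) (M : ℤ) := isCoprime_apply_one_one_level γ
      exact (hN'.of_isCoprime_of_dvd_right (Int.natCast_dvd_natCast.mpr hNM)).mul_right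
        (isCoprime_apply_zero_one_apply_one_one γ).symm
    · refine Finset.sum_congr rfl fun T hT => ?_
      have hTpos : (∏ t ∈ T, t) ≠ 0 := Finset.prod_ne_zero_iff.mpr fun t ht =>
        (hpos t (List.mem_toFinset.mp (Finset.mem_powerset.mp hT ht))).ne'
      haveI : NeZero (∏ t ∈ T, t) := ⟨hTpos⟩
      have hTdvd : N * ∏ t ∈ T, t ∣ M := by
        refine mul_dvd_mul_left N ?_
        have hprod : ds.prod = ∏ t ∈ ds.toFinset, t := by
          rw [List.prod_toFinset (fun t : ℕ => t) hnd, List.map_id']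
        rw [hprod]
        exact Finset.prod_dvd_prod_of_subset _ _ _ (Finset.mem_powerset.mp hT)
      have h01 : ((Gamma0.degeneracyConj N M (∏ t ∈ T, t) hTdvd γ : SL(2, ℤ)) 0 1 : ℤ) =
          ((∏ t ∈ T, t : ℕ) : ℤ) * (γ : SL(2, ℤ)) 0 1 := rfl
      have h11 : ((Gamma0.degeneracyConj N M (∏ t ∈ T, t) hTdvd γ : SL(2, ℤ)) 1 1 : ℤ) =
          (γ : SL(2, ℤ)) 1 1 := rfl
      rw [AddSubgroupClass.coe_zsmul]
      show (-1 : ℤ) ^ T.card • cuspSymbol f (conjAt N M (∏ t ∈ T, t) γ) = _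
      rw [conjAt_eq hTdvd γ, cuspSymbol_eq_modularSymbol_div_sub f _ (by rw [h11]; exact he), h01, h11,
        zsmul_eq_mul]
      have harg : ((((∏ t ∈ T, t : ℕ) : ℤ) * (γ : SL(2, ℤ)) 0 1 : ℤ) : ℚ) / (((γ : SL(2, ℤ)) 1 1 : ℤ) : ℚ) =
          ((((γ : SL(2, ℤ)) 0 1 * ∏ t ∈ T, (t : ℤ) : ℤ)) : ℚ) / (((γ : SL(2, ℤ)) 1 1 : ℤ) : ℚ) := by
        push_cast
        ring
      rw [harg]
      push_cast
      ring
  have hu0 : u = 0 :=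
    eq_zero_of_altSum_conjAt_eq_zero S _ N ds hnd hpos hRI N M (dvd_refl N) hM hSM u hgen hsum
  -- `u_φ = 0` forces `φ = 0`
  ext x
  have hx : (x : ℂ) ∈ (periodLattice f : Set ℂ) := x.2
  rw [coe_periodLattice_eq_range] at hx
  obtain ⟨γ, hγ⟩ := hx
  have hxγ : x = ⟨cuspSymbol f γ, cuspSymbol_mem_periodLattice f γ⟩ := Subtype.ext hγ.symm
  have h0 : (u : Gamma0 N → Fin 1 → ZMod 2) γ 0 = 0 := by rw [hu0]; rfl
  rw [hxγ, AddMonoidHom.zero_apply]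
  exact h0

/-- **Per-curve core at `p = 2`**: for a `W`-newform `f`, `4 ∣ N`, and `φ : Λ_f → 𝔽₂` killing `Λ_{h₂}`, the single-shift
vanishing for Hecke-generalised eigen-cocycles of `ℓ ↦ a_ℓ(W)` at the moduli `2³` and `t¹` (`t` odd prime), at all levels
`N ∣ L'` (no Eisenstein hypothesis — the caller discharges it), forces `φ = 0` (tower `N → 8N → 8Nq₁ → ⋯`). [folklore] -/
theorem functional_eq_zero_of_shiftVanishing_two {W : WeierstrassCurve ℚ} [W.IsElliptic] {N : ℕ} [NeZero N]
    {f : CuspForm (Gamma0 N) 2} (hf : IsNewformOf W f) (h4 : 2 ^ 2 ∣ N) (φ : ↥(periodLattice f) →+ ZMod 2)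
    (hφ : ∀ x : ↥(periodLattice f), (x : ℂ) ∈
      periodLattice (∑ T ∈ (insert 8 (N.primeFactors.filter fun q => ¬ q ^ 2 ∣ N)).powerset,
        (-1 : ℂ) ^ T.card • degeneracyMap0 N (8 * N ^ 2) (∏ t ∈ T, t - 1 + 1) 2 f) → φ x = 0)
    (hvan8 : ∀ (L' : ℕ) [NeZero L'] (S : Finset ℕ) (v : cocycles 0 L' (ZMod 2)), N ∣ L' →
      (∀ q : ℕ, q.Prime → q ∣ 2 * 2 * L' → q ∈ S) →
      IsHeckeGenEigenvector S (fun ℓ : ℕ => ((W.LFunction ℓ : ℤ) : ZMod 2)) v →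
      degeneracyPullback 0 L' (L' * 2 ^ 3) (2 ^ 3) (ZMod 2) dvd_rfl (v : Gamma0 L' → Fin 1 → ZMod 2) =
        degeneracyPullback 0 L' (L' * 2 ^ 3) 1 (ZMod 2) (by simp) (v : Gamma0 L' → Fin 1 → ZMod 2) →
      v = 0)
    (hvanq : ∀ t : ℕ, t.Prime → t ≠ 2 →
      ∀ (L' : ℕ) [NeZero L'] [NeZero t] (S : Finset ℕ) (v : cocycles 0 L' (ZMod 2)), N ∣ L' →
      (∀ q : ℕ, q.Prime → q ∣ 2 * t * L' → q ∈ S) →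
      IsHeckeGenEigenvector S (fun ℓ : ℕ => ((W.LFunction ℓ : ℤ) : ZMod 2)) v →
      degeneracyPullback 0 L' (L' * t ^ 1) (t ^ 1) (ZMod 2) dvd_rfl (v : Gamma0 L' → Fin 1 → ZMod 2) =
        degeneracyPullback 0 L' (L' * t ^ 1) 1 (ZMod 2) (by simp) (v : Gamma0 L' → Fin 1 → ZMod 2) →
      v = 0) :
    φ = 0 := by
  haveI : Fact (Nat.Prime 2) := ⟨Nat.prime_two⟩
  have hN0 : 0 < N := Nat.pos_of_ne_zero (NeZero.ne N)
  have h4' : 4 ∣ N := by norm_num at h4; exact h4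
  have h2N : 2 ∣ N := dvd_trans (by norm_num) h4'
  set G : Finset ℕ := N.primeFactors.filter fun q => ¬ q ^ 2 ∣ N with hG
  have hGprime : ∀ q ∈ G, q.Prime ∧ ¬ q ^ 2 ∣ N := fun q hq => by
    rw [hG, Finset.mem_filter] at hq
    exact ⟨(Nat.mem_primeFactors.mp hq.1).1, hq.2⟩
  have hGne2 : ∀ q ∈ G, q ≠ 2 := by
    rintro q hq rfl
    exact (hGprime 2 hq).2 h4
  set ds : List ℕ := (2 ^ 3) :: (G.toList.map fun t => t ^ 1) with hds
  have hmap : (G.toList.map fun t => t ^ 1) = G.toList := by simp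
  have h8G : (2 ^ 3 : ℕ) ∉ G.toList := fun h => by
    have h8 := (hGprime _ (Finset.mem_toList.mp h)).1
    norm_num at h8
  have hnd : ds.Nodup := by
    rw [hds, hmap]
    exact List.nodup_cons.mpr ⟨h8G, Finset.nodup_toList G⟩
  have hpos : ∀ d ∈ ds, 0 < d := by
    intro d hd
    rw [hds, hmap] at hd
    rcases List.mem_cons.mp hd with rfl | hd
    · norm_num
    · exact (hGprime d (Finset.mem_toList.mp hd)).1.pos
  have hdsF : ds.toFinset = insert 8 G := by
    rw [hds, hmap, List.toFinset_cons, Finset.toList_toFinset]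
    norm_num
  have hprod0 : ds.prod ≠ 0 := fun h0 => lt_irrefl 0 (hpos 0 (List.prod_eq_zero_iff.mp h0))
  set M : ℕ := N * ds.prod with hM
  have hM0 : M ≠ 0 := Nat.mul_ne_zero (NeZero.ne N) hprod0
  haveI : NeZero M := ⟨hM0⟩
  have hNM : N ∣ M := dvd_mul_right N _
  have hL : 1 < M := lt_of_lt_of_le (by omega : 1 < N) (Nat.le_of_dvd (Nat.pos_of_ne_zero hM0) hNM)
  set S : Finset ℕ := M.primeFactors with hS
  have hSM : ∀ q : ℕ, q.Prime → q ∣ M → q ∈ S := fun q hq hqd =>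
    (Nat.mem_primeFactors_of_ne_zero hM0).mpr ⟨hq, hqd⟩
  set u : cocycles 0 N (ZMod 2) :=
    ⟨fun (γ : Gamma0 N) (_ : Fin 1) => φ ⟨cuspSymbol f γ, cuspSymbol_mem_periodLattice f γ⟩,
      functionalCocycle_mem_cocycles f φ⟩ with hu
  have hgen : IsHeckeGenEigenvector S (fun ℓ : ℕ => ((W.LFunction ℓ : ℤ) : ZMod 2)) u :=
    isHeckeGenEigenvector_functionalCocycle hf φ S
  have hRI : ∀ d ∈ ds, ∀ (L' : ℕ) [NeZero L'] [NeZero d] (v : cocycles 0 L' (ZMod 2)), N ∣ L' →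
      (∀ q : ℕ, q.Prime → q ∣ L' * d → q ∈ S) →
      IsHeckeGenEigenvector S (fun ℓ : ℕ => ((W.LFunction ℓ : ℤ) : ZMod 2)) v →
      degeneracyPullback 0 L' (L' * d) d (ZMod 2) dvd_rfl (v : Gamma0 L' → Fin 1 → ZMod 2) =
        degeneracyPullback 0 L' (L' * d) 1 (ZMod 2) (by simp) (v : Gamma0 L' → Fin 1 → ZMod 2) →
      v = 0 := by
    intro d hd
    rw [hds] at hd
    rcases List.mem_cons.mp hd with rfl | hd
    · intro L' _ _ v hNL hS' hv heq
      refine hvan8 L' S v hNL (fun q hq hqd => ?_) hv heq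
      rcases (Nat.Prime.dvd_mul hq).mp hqd with h | h
      · have h2 : q ∣ 2 := by rcases (Nat.Prime.dvd_mul hq).mp h with h | h <;> exact h
        have hq2 : q = 2 := (Nat.prime_dvd_prime_iff_eq hq Nat.prime_two).mp h2
        subst hq2
        exact hS' 2 hq (dvd_mul_of_dvd_right (by norm_num) _)
      · exact hS' q hq (h.mul_right _)
    · obtain ⟨t, ht, rfl⟩ := List.mem_map.mp hd
      have htp := (hGprime t (Finset.mem_toList.mp ht)).1
      have ht2 := hGne2 t (Finset.mem_toList.mp ht)
      intro L' _ _ v hNL hS' hv heq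
      haveI : NeZero t := ⟨htp.ne_zero⟩
      refine hvanq t htp ht2 L' S v hNL (fun q hq hqd => ?_) hv heq
      rcases (Nat.Prime.dvd_mul hq).mp hqd with h | h
      · rcases (Nat.Prime.dvd_mul hq).mp h with h | h
        · have hq2 : q = 2 := (Nat.prime_dvd_prime_iff_eq hq Nat.prime_two).mp h
          subst hq2
          exact hS' 2 hq ((h2N.trans hNL).mul_right _)
        · exact hS' q hq (dvd_mul_of_dvd_right (by rw [pow_one]; exact h) _)
      · exact hS' q hq (h.mul_right _)
  have hsum : ∀ (γ : Gamma0 M) (i : Fin 1),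
      ∑ T ∈ ds.toFinset.powerset,
        (-1 : ℤ) ^ T.card • (u : Gamma0 N → Fin 1 → ZMod 2) (conjAt N M (∏ t ∈ T, t) γ) i = 0 := by
    intro γ i
    have he : ((γ : SL(2, ℤ)) 1 1 : ℤ) ≠ 0 := apply_one_one_ne_zero_of_one_lt hL γ
    have hterm : ∀ T ∈ ds.toFinset.powerset,
        (-1 : ℤ) ^ T.card • (u : Gamma0 N → Fin 1 → ZMod 2) (conjAt N M (∏ t ∈ T, t) γ) i =
          φ ((-1 : ℤ) ^ T.card •
            ⟨cuspSymbol f (conjAt N M (∏ t ∈ T, t) γ), cuspSymbol_mem_periodLattice f _⟩) := by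
      intro T _
      rw [map_zsmul]
    rw [Finset.sum_congr rfl hterm, ← map_sum]
    apply hφ
    rw [AddSubmonoidClass.coe_finsetSum, periodLattice_multiShiftOldform_eq_closure_columns f h4', ← hdsF]
    apply AddSubgroup.subset_closure
    refine ⟨((γ : SL(2, ℤ)) 0 1 : ℤ), ((γ : SL(2, ℤ)) 1 1 : ℤ), he, ?_, ?_⟩
    · have hN' : IsCoprime ((γ : SL(2, ℤ)) 1 1 : ℤ) (M : ℤ) := isCoprime_apply_one_one_level γ
      exact (hN'.of_isCoprime_of_dvd_right (Int.natCast_dvd_natCast.mpr hNM)).mul_right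
        (isCoprime_apply_zero_one_apply_one_one γ).symm
    · refine Finset.sum_congr rfl fun T hT => ?_
      have hTpos : (∏ t ∈ T, t) ≠ 0 := Finset.prod_ne_zero_iff.mpr fun t ht =>
        (hpos t (List.mem_toFinset.mp (Finset.mem_powerset.mp hT ht))).ne'
      haveI : NeZero (∏ t ∈ T, t) := ⟨hTpos⟩
      have hTdvd : N * ∏ t ∈ T, t ∣ M := by
        refine mul_dvd_mul_left N ?_
        have hprod : ds.prod = ∏ t ∈ ds.toFinset, t := by
          rw [List.prod_toFinset (fun t : ℕ => t) hnd, List.map_id']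
        rw [hprod]
        exact Finset.prod_dvd_prod_of_subset _ _ _ (Finset.mem_powerset.mp hT)
      have h01 : ((Gamma0.degeneracyConj N M (∏ t ∈ T, t) hTdvd γ : SL(2, ℤ)) 0 1 : ℤ) =
          ((∏ t ∈ T, t : ℕ) : ℤ) * (γ : SL(2, ℤ)) 0 1 := rfl
      have h11 : ((Gamma0.degeneracyConj N M (∏ t ∈ T, t) hTdvd γ : SL(2, ℤ)) 1 1 : ℤ) =
          (γ : SL(2, ℤ)) 1 1 := rfl
      rw [AddSubgroupClass.coe_zsmul]
      show (-1 : ℤ) ^ T.card • cuspSymbol f (conjAt N M (∏ t ∈ T, t) γ) = _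
      rw [conjAt_eq hTdvd γ, cuspSymbol_eq_modularSymbol_div_sub f _ (by rw [h11]; exact he), h01, h11,
        zsmul_eq_mul]
      have harg : ((((∏ t ∈ T, t : ℕ) : ℤ) * (γ : SL(2, ℤ)) 0 1 : ℤ) : ℚ) / (((γ : SL(2, ℤ)) 1 1 : ℤ) : ℚ) =
          ((((γ : SL(2, ℤ)) 0 1 * ∏ t ∈ T, (t : ℤ) : ℤ)) : ℚ) / (((γ : SL(2, ℤ)) 1 1 : ℤ) : ℚ) := by
        push_cast
        ring
      rw [harg]
      push_cast
      ring
  have hu0 : u = 0 :=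
    eq_zero_of_altSum_conjAt_eq_zero S _ N ds hnd hpos hRI N M (dvd_refl N) hM hSM u hgen hsum
  ext x
  have hx : (x : ℂ) ∈ (periodLattice f : Set ℂ) := x.2
  rw [coe_periodLattice_eq_range] at hx
  obtain ⟨γ, hγ⟩ := hx
  have hxγ : x = ⟨cuspSymbol f γ, cuspSymbol_mem_periodLattice f γ⟩ := Subtype.ext hγ.symm
  have h0 : (u : Gamma0 N → Fin 1 → ZMod 2) γ 0 = 0 := by rw [hu0]; rfl
  rw [hxγ, AddMonoidHom.zero_apply]
  exact h0

/-- **E-es-22 ⟸ E-es-25-Bar at `(2,2,3)`, `(2,q,1)` (`q` odd prime) ∧ its Eisenstein residual** (es g10, MEMO-es §22 /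
P-es-4: the OFFICIAL E-es-25 is `EsG10.RelativeIharaShiftVanishingBar p t n`, two characters over `K̄`; bodies VERBATIM as
`hRI8`, `hRIq`). `hRes` = E-es-22 in functional form for the RESIDUAL curves whose `ℓ ↦ a_ℓ(W) mod 2` IS Eisenstein over
`𝔽̄₂` although `W[2]` is irreducible (the `C₃`-image curves, row E-es-22[C₃]); no curve-side Galois fact assumed. [folklore] -/
theorem multiShiftClassGenerationTwo_of_relativeIharaBar
    (hRI8 : ∀ (K : Type) [Field K] [CharP K 2] (L : ℕ) [NeZero L] [NeZero (2 : ℕ)] (S : Finset ℕ) (lam : ℕ → K)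
      (u : cocycles 0 L K),
      (∀ q : ℕ, q.Prime → q ∣ 2 * 2 * L → q ∈ S) →
      IsHeckeGenEigenvector S lam u →
      ¬ IsEisensteinEigensystem 2 (fun ℓ => algebraMap K (AlgebraicClosure K) (lam ℓ)) →
      degeneracyPullback 0 L (L * 2 ^ 3) (2 ^ 3) K dvd_rfl (u : Gamma0 L → Fin 1 → K) =
        degeneracyPullback 0 L (L * 2 ^ 3) 1 K (by simp) (u : Gamma0 L → Fin 1 → K) →
      u = 0)
    (hRIq : ∀ t : ℕ, t.Prime → t ≠ 2 →
      ∀ (K : Type) [Field K] [CharP K 2] (L : ℕ) [NeZero L] [NeZero t] (S : Finset ℕ) (lam : ℕ → K)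
      (u : cocycles 0 L K),
      (∀ q : ℕ, q.Prime → q ∣ 2 * t * L → q ∈ S) →
      IsHeckeGenEigenvector S lam u →
      ¬ IsEisensteinEigensystem 2 (fun ℓ => algebraMap K (AlgebraicClosure K) (lam ℓ)) →
      degeneracyPullback 0 L (L * t ^ 1) (t ^ 1) K dvd_rfl (u : Gamma0 L → Fin 1 → K) =
        degeneracyPullback 0 L (L * t ^ 1) 1 K (by simp) (u : Gamma0 L → Fin 1 → K) →
      u = 0)
    (hRes : ∀ (W : WeierstrassCurve ℚ) [W.IsElliptic] {N : ℕ} [NeZero N] (f : CuspForm (Gamma0 N) 2),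
      IsNewformOf W f → 2 ^ 2 ∣ N → W.HasIrreducibleModPGaloisRep 2 →
      IsEisensteinEigensystem 2
        (fun ℓ : ℕ => algebraMap (ZMod 2) (AlgebraicClosure (ZMod 2)) ((W.LFunction ℓ : ℤ) : ZMod 2)) →
      ∀ φ : ↥(periodLattice f) →+ ZMod 2,
        (∀ x : ↥(periodLattice f), (x : ℂ) ∈
            periodLattice (∑ T ∈ (insert 8 (N.primeFactors.filter fun q => ¬ q ^ 2 ∣ N)).powerset,
              (-1 : ℂ) ^ T.card • degeneracyMap0 N (8 * N ^ 2) (∏ t ∈ T, t - 1 + 1) 2 f) → φ x = 0) →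
        φ = 0) :
    MultiShiftClassGenerationTwo := by
  haveI : Fact (Nat.Prime 2) := ⟨Nat.prime_two⟩
  rw [multiShiftClassGenerationTwo_iff_functionals]
  intro W _ N _ f hf h4 hirr φ hφ
  by_cases hE : IsEisensteinEigensystem 2
      (fun ℓ : ℕ => algebraMap (ZMod 2) (AlgebraicClosure (ZMod 2)) ((W.LFunction ℓ : ℤ) : ZMod 2))
  · exact hRes W f hf h4 hirr hE φ hφ
  · refine functional_eq_zero_of_shiftVanishing_two hf h4 φ hφ ?_ ?_
    · intro L' _ S v _ hS hv heq
      exact hRI8 (ZMod 2) L' S _ v hS hv hE heq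
    · intro t ht ht2 L' _ _ S v _ hS hv heq
      exact hRIq t ht ht2 (ZMod 2) L' S _ v hS hv hE heq

end Summit.BirchSwinnertonDyer.BirchSwinnertonDyer.Theorems.ManinLocalTwoThree

end
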